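import Literature.NumberTheory.GelbartRogawski1991.UnitaryDualPairSplittingDatumCongruence
import HarnessLib

/-!
# Pointwise Schwartz–Bruhat domination of `ω_ψ(p)Φ` transports along Levi conjugation, relabelling, and the
# Gelbart–Rogawski congruence transport `congrMp`

Topic `NumberTheory/GelbartRogawski1991`; namespace `Literature.NumberTheory.GelbartRogawski1991.UnitaryDualPair`.  PROOF lane
(theorems only; no `def`, no named fact, no instance, no `sorry`).

A family `(p_u)_{u ∈ C}` in Weil's metaplectic group of record `Mp_ψ(𝕎_𝔸)ᶜᵒⁿᵗ` (`adelicMpCont F (Fin n) T`) is **dominated** when for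
every Schwartz–Bruhat `Φ` there is ONE real non-negative Schwartz–Bruhat `Φ₀` with `|ω_ψ(p_u)Φ (x)| ≤ Φ₀(x)` for all `u ∈ C` and all
`x ∈ 𝔸_Fⁿ` (Weil (1964) n° 41 Lemme 5; the shape of ★ `Weil1964.exists_piSchwartzBruhat_dominating_omega_conj_pairSplitting_inr_of_signs`,
spelled INLINE below — no definition is introduced).  We prove that domination transports:

* `exists_dominating_omega_leviConj` — along the inner conjugation by Weil's LEVI pair `m_𝕋(b)` (★ `leviConj`): `ω(m(b))` is the pure
  twist `Ψ ↦ Ψ(· ᵥ* (b⁻¹)ᵀ)` (★ `omegaPsi_leviPair_apply`), so `Φ₀ ↦ ω(m(b)) Φ₀′` with `Φ₀′` the dominator of `ω(m(b))⁻¹ Φ`;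
* `exists_dominating_omega_relabel` ∕ `…_relabel_symm` — along the relabelling of record `Mp_ψ(𝕎_{T′})ᶜᵒⁿᵗ ≃* Mp_ψ(𝕎_T)ᶜᵒⁿᵗ`
  (★ `adelicMpCont.omega_relabel`: the operator does not move);
* `exists_dominating_omega_congrMp` — along the GELBART–ROGAWSKI CONGRUENCE TRANSPORT `φ = congrMp : Mp(𝕎_𝔸) →* Mp(𝕎′_𝔸)` to the
  congruent data `(P_Vᵀ T_V P_V, P_Wᵀ T_W P_W)` (★ `congrMp_apply`: `φ = relabel ∘ leviConj(𝕡⁻¹)`), and the conjugated-family form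
  `exists_dominating_omega_conj_congrMp` for the families `q · g_u · q⁻¹` of the domination letters.

This is the «domination transports VERBATIM» step of the A6 input adapter of cell `hodgecm-mathlib` (crux H413, P4 E-2 SW2 (iii),
`E2SWBorelBoundLettersCM.hdom_CM`): Lemme 5 is proved at DIAGONAL data and every non-degenerate symmetric datum is congruent to a
diagonal one.  [cite: Weil1964, Chap. III n° 41, Lemme 5 p. 194] [cite: Weil1964, Chap. I n° 13 p. 160]
[cite: GelbartRogawski1991, §3.1 p. 454 L41–42] [cite: MoeglinVignerasWaldspurger1987, Chap. 2 II.1 (B)]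
-/

set_option autoImplicit false

noncomputable section

open scoped Matrix
open NumberField
open Literature.NumberTheory.Automorphic
open Literature.NumberTheory.Weil1964

namespace Literature.NumberTheory.GelbartRogawski1991

namespace UnitaryDualPair

/-! ## §1 Levi conjugation -/

section Levi

variable (F : Type) [Field F] [NumberField F] {n : ℕ} (T : Matrix (Fin n) (Fin n) (AdeleRing (𝓞 F) F))
  (hT : IsUnit T.det)

/-- the operator of the Levi pair of record is the twist `Ψ ↦ Ψ(· ᵥ* (b⁻¹)ᵀ)` (★ `omegaPsi_leviPair_apply` on `Mp_ψ(𝕎_𝔸)ᶜᵒⁿᵗ`).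
[cite: Weil1964, Chap. I n° 13 p. 160] -/
theorem omega_leviPairCont_apply (b : GL (Fin n) (AdeleRing (𝓞 F) F)) (Ψ : piSchwartzBruhat F (Fin n))
    (x : Fin n → AdeleRing (𝓞 F) F) :
    ((adelicMpCont.omega F (Fin n) T (leviPairCont F T hT b) Ψ : piSchwartzBruhat F (Fin n)) :
        (Fin n → AdeleRing (𝓞 F) F) → ℂ) x =
      (Ψ : (Fin n → AdeleRing (𝓞 F) F) → ℂ)
        (x ᵥ* ((trInv b : GL (Fin n) (AdeleRing (𝓞 F) F)) : Matrix (Fin n) (Fin n) (AdeleRing (𝓞 F) F))) :=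
  omegaPsi_leviPair_apply F T hT b Ψ x

/-- `ω(m(b) p m(b)⁻¹)Φ = ω(m(b)) (ω(p) (ω(m(b)⁻¹) Φ))`. [cite: Weil1964, Chap. I n° 13 p. 160] -/
theorem omega_leviConj_apply (b : GL (Fin n) (AdeleRing (𝓞 F) F)) (p : adelicMpCont F (Fin n) T)
    (Φ : piSchwartzBruhat F (Fin n)) :
    adelicMpCont.omega F (Fin n) T (leviConj F T hT b p) Φ =
      adelicMpCont.omega F (Fin n) T (leviPairCont F T hT b)
        (adelicMpCont.omega F (Fin n) T p (adelicMpCont.omega F (Fin n) T (leviPairCont F T hT b)⁻¹ Φ)) :=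
  -- term-mode chain (no `rw` under `ω`: isDefEq would unfold the Weil operators)
  LinearMap.congr_fun
    ((congrArg (adelicMpCont.omega F (Fin n) T) (leviConj_apply F T hT b p)).trans
      ((map_mul (adelicMpCont.omega F (Fin n) T) _ _).trans
        (congrArg (· * adelicMpCont.omega F (Fin n) T (leviPairCont F T hT b)⁻¹)
          (map_mul (adelicMpCont.omega F (Fin n) T) _ _)))) Φ

/-- **DOMINATION TRANSPORTS ALONG LEVI CONJUGATION.**  If for every `Φ` the family `(ω(p_u)Φ)_{u ∈ C}` is dominated pointwise by
one real non-negative Schwartz–Bruhat function, then so is `(ω(m(b) p_u m(b)⁻¹)Φ)_{u ∈ C}` for Weil's Levi pair `m(b)` of any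
`b ∈ GL_n(𝔸_F)`: `ω(m(b))` is the twist by `(b⁻¹)ᵀ`, which preserves Schwartz–Bruhat functions, reality and non-negativity.
[cite: Weil1964, Chap. III n° 41, Lemme 5 p. 194] -/
theorem exists_dominating_omega_leviConj {κ : Type*} (C : Set κ) (f : κ → adelicMpCont F (Fin n) T)
    (b : GL (Fin n) (AdeleRing (𝓞 F) F))
    (h : ∀ Φ : piSchwartzBruhat F (Fin n), ∃ Φ₀ : (Fin n → AdeleRing (𝓞 F) F) → ℂ, Φ₀ ∈ piSchwartzBruhat F (Fin n) ∧
      (∀ x, (Φ₀ x).im = 0 ∧ 0 ≤ (Φ₀ x).re) ∧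
        ∀ u ∈ C, ∀ x, ‖((adelicMpCont.omega F (Fin n) T (f u) Φ : piSchwartzBruhat F (Fin n)) :
          (Fin n → AdeleRing (𝓞 F) F) → ℂ) x‖ ≤ (Φ₀ x).re)
    (Φ : piSchwartzBruhat F (Fin n)) :
    ∃ Φ₀ : (Fin n → AdeleRing (𝓞 F) F) → ℂ, Φ₀ ∈ piSchwartzBruhat F (Fin n) ∧
      (∀ x, (Φ₀ x).im = 0 ∧ 0 ≤ (Φ₀ x).re) ∧
        ∀ u ∈ C, ∀ x, ‖((adelicMpCont.omega F (Fin n) T (leviConj F T hT b (f u)) Φ : piSchwartzBruhat F (Fin n)) :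
          (Fin n → AdeleRing (𝓞 F) F) → ℂ) x‖ ≤ (Φ₀ x).re :=
  -- TERM MODE throughout: `rcases`/`obtain` on a goal carrying `ω`/`leviConj` terms whnf-times out (the cases motive), so the
  -- dominator `Φ₀′` of `Ψ := ω(m(b))⁻¹ Φ` is eliminated with `Exists.elim` and `Θ := ω(m(b)) Φ₀′` is written inline.
  (h (adelicMpCont.omega F (Fin n) T (leviPairCont F T hT b)⁻¹ Φ)).elim fun Φ₀' hΦ₀' =>
    ⟨((adelicMpCont.omega F (Fin n) T (leviPairCont F T hT b) ⟨Φ₀', hΦ₀'.1⟩ : piSchwartzBruhat F (Fin n)) :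
        (Fin n → AdeleRing (𝓞 F) F) → ℂ),
      (adelicMpCont.omega F (Fin n) T (leviPairCont F T hT b) ⟨Φ₀', hΦ₀'.1⟩).2,
      fun x =>
        ⟨(congrArg Complex.im (omega_leviPairCont_apply F T hT b ⟨Φ₀', hΦ₀'.1⟩ x)).trans (hΦ₀'.2.1 _).1,
          (hΦ₀'.2.1 _).2.trans_eq (congrArg Complex.re (omega_leviPairCont_apply F T hT b ⟨Φ₀', hΦ₀'.1⟩ x)).symm⟩,
      fun u hu x =>
        -- `(ω(m(b) p_u m(b)⁻¹)Φ)(x) = (ω(p_u)Ψ)(x (b⁻¹)ᵀ) ≤ Φ₀′(x (b⁻¹)ᵀ) = Θ(x)`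
        (congrArg (fun z : ℂ => ‖z‖)
          ((congrFun (congrArg (fun Θ' : piSchwartzBruhat F (Fin n) => ((Θ' : piSchwartzBruhat F (Fin n)) :
              (Fin n → AdeleRing (𝓞 F) F) → ℂ)) (omega_leviConj_apply F T hT b (f u) Φ)) x).trans
            (omega_leviPairCont_apply F T hT b _ x))).trans_le
          ((hΦ₀'.2.2 u hu _).trans_eq (congrArg Complex.re (omega_leviPairCont_apply F T hT b ⟨Φ₀', hΦ₀'.1⟩ x)).symm)⟩

end Levi

/-! ## §2 Relabelling -/

section Relabel

variable (F : Type) [Field F] [NumberField F] {n : ℕ} {T T' : Matrix (Fin n) (Fin n) (AdeleRing (𝓞 F) F)}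
  (Cg : GL (Fin n) (AdeleRing (𝓞 F) F)) (hC : T * (Cg : Matrix (Fin n) (Fin n) (AdeleRing (𝓞 F) F)) = T')

/-- **DOMINATION TRANSPORTS ALONG THE RELABELLING OF RECORD** `Mp_ψ(𝕎_{T′})ᶜᵒⁿᵗ ≃* Mp_ψ(𝕎_T)ᶜᵒⁿᵗ` — the operator `ω(p)` does not move
(★ `adelicMpCont.omega_relabel`), so the same dominator serves. [cite: GelbartRogawski1991, §3.1 p. 454 L41–42] -/
theorem exists_dominating_omega_relabel {κ : Type*} (C : Set κ) (f : κ → adelicMpCont F (Fin n) T')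
    (Φ : piSchwartzBruhat F (Fin n))
    (h : ∃ Φ₀ : (Fin n → AdeleRing (𝓞 F) F) → ℂ, Φ₀ ∈ piSchwartzBruhat F (Fin n) ∧
      (∀ x, (Φ₀ x).im = 0 ∧ 0 ≤ (Φ₀ x).re) ∧
        ∀ u ∈ C, ∀ x, ‖((adelicMpCont.omega F (Fin n) T' (f u) Φ : piSchwartzBruhat F (Fin n)) :
          (Fin n → AdeleRing (𝓞 F) F) → ℂ) x‖ ≤ (Φ₀ x).re) :
    ∃ Φ₀ : (Fin n → AdeleRing (𝓞 F) F) → ℂ, Φ₀ ∈ piSchwartzBruhat F (Fin n) ∧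
      (∀ x, (Φ₀ x).im = 0 ∧ 0 ≤ (Φ₀ x).re) ∧
        ∀ u ∈ C, ∀ x, ‖((adelicMpCont.omega F (Fin n) T (adelicMpContRelabel F (Fin n) Cg hC (f u)) Φ :
          piSchwartzBruhat F (Fin n)) : (Fin n → AdeleRing (𝓞 F) F) → ℂ) x‖ ≤ (Φ₀ x).re := by
  obtain ⟨Φ₀, hmem, hre, hdom⟩ := h
  refine ⟨Φ₀, hmem, hre, fun u hu x => ?_⟩
  rw [adelicMpCont.omega_relabel]
  exact hdom u hu x

/-- the inverse relabelling: domination on `Mp_ψ(𝕎_T)ᶜᵒⁿᵗ` gives domination of the preimage family on `Mp_ψ(𝕎_{T′})ᶜᵒⁿᵗ`.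
[cite: GelbartRogawski1991, §3.1 p. 454 L41–42] -/
theorem exists_dominating_omega_relabel_symm {κ : Type*} (C : Set κ) (f : κ → adelicMpCont F (Fin n) T)
    (Φ : piSchwartzBruhat F (Fin n))
    (h : ∃ Φ₀ : (Fin n → AdeleRing (𝓞 F) F) → ℂ, Φ₀ ∈ piSchwartzBruhat F (Fin n) ∧
      (∀ x, (Φ₀ x).im = 0 ∧ 0 ≤ (Φ₀ x).re) ∧
        ∀ u ∈ C, ∀ x, ‖((adelicMpCont.omega F (Fin n) T (f u) Φ : piSchwartzBruhat F (Fin n)) :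
          (Fin n → AdeleRing (𝓞 F) F) → ℂ) x‖ ≤ (Φ₀ x).re) :
    ∃ Φ₀ : (Fin n → AdeleRing (𝓞 F) F) → ℂ, Φ₀ ∈ piSchwartzBruhat F (Fin n) ∧
      (∀ x, (Φ₀ x).im = 0 ∧ 0 ≤ (Φ₀ x).re) ∧
        ∀ u ∈ C, ∀ x, ‖((adelicMpCont.omega F (Fin n) T' ((adelicMpContRelabel F (Fin n) Cg hC).symm (f u)) Φ :
          piSchwartzBruhat F (Fin n)) : (Fin n → AdeleRing (𝓞 F) F) → ℂ) x‖ ≤ (Φ₀ x).re := by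
  obtain ⟨Φ₀, hmem, hre, hdom⟩ := h
  refine ⟨Φ₀, hmem, hre, fun u hu x => ?_⟩
  rw [← adelicMpCont.omega_relabel F (Fin n) Cg hC ((adelicMpContRelabel F (Fin n) Cg hC).symm (f u)),
    MulEquiv.apply_symm_apply]
  exact hdom u hu x

end Relabel

/-! ## §3 The Gelbart–Rogawski congruence transport `congrMp` -/

section Congr

variable (F : Type) [Field F] [NumberField F] {N M n : ℕ} (e : Fin N × Fin M ≃ Fin n)
  {TV : Matrix (Fin N) (Fin N) F} {TW : Matrix (Fin M) (Fin M) F}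
  (hVd : IsUnit TV.det) (hWd : IsUnit TW.det)
  {PV : Matrix (Fin N) (Fin N) F} {PW : Matrix (Fin M) (Fin M) F} (hPV : IsUnit PV.det) (hPW : IsUnit PW.det)

/-- `ω(φ p)Φ = ω(m(𝕡⁻¹) p m(𝕡⁻¹)⁻¹)Φ` for the congruence transport `φ = relabel ∘ leviConj(𝕡⁻¹)` (★ `congrMp_apply`, ★
`adelicMpCont.omega_relabel`). [cite: MoeglinVignerasWaldspurger1987, Chap. 2 II.1 (B)] -/
theorem omega_congrMp (p : adelicMpCont F (Fin n) (adelicGram F e TV TW)) :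
    adelicMpCont.omega F (Fin n) (adelicGram F e (PVᵀ * TV * PV) (PWᵀ * TW * PW)) (congrMp F e hVd hWd hPV hPW p) =
      adelicMpCont.omega F (Fin n) (adelicGram F e TV TW)
        (leviConj F (adelicGram F e TV TW) (isUnit_det_adelicGram F e hVd hWd) (ratGL F (gramGL F e hPV hPW)⁻¹) p) :=
  (congrArg (adelicMpCont.omega F (Fin n) (adelicGram F e (PVᵀ * TV * PV) (PWᵀ * TW * PW)))
      (congrMp_apply F e hVd hWd hPV hPW p)).trans
    (adelicMpCont.omega_relabel F (Fin n)
      (relabelGL F (Fin n) (isUnit_det_adelicGram_congr F e hVd hWd hPV hPW) (isUnit_det_adelicGram F e hVd hWd))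
      (mul_relabelGL F (Fin n) (isUnit_det_adelicGram_congr F e hVd hWd hPV hPW) (isUnit_det_adelicGram F e hVd hWd))
      (leviConj F (adelicGram F e TV TW) (isUnit_det_adelicGram F e hVd hWd) (ratGL F (gramGL F e hPV hPW)⁻¹) p))

/-- **DOMINATION TRANSPORTS ALONG THE GELBART–ROGAWSKI CONGRUENCE TRANSPORT** `φ : Mp_ψ(𝕎_𝔸)ᶜᵒⁿᵗ →* Mp_ψ(𝕎′_𝔸)ᶜᵒⁿᵗ` to the
congruent data `(P_Vᵀ T_V P_V, P_Wᵀ T_W P_W)`: if for every `Φ` the family `(ω(p_u)Φ)_{u ∈ C}` is dominated pointwise by one real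
non-negative Schwartz–Bruhat function, then so is `(ω(φ p_u)Φ)_{u ∈ C}` — Weil's Lemme 5 proved at diagonal data therefore holds at
every congruent datum. [cite: Weil1964, Chap. III n° 41, Lemme 5 p. 194] [cite: GelbartRogawski1991, §3.1 p. 454 L41–42] -/
theorem exists_dominating_omega_congrMp {κ : Type*} (C : Set κ) (f : κ → adelicMpCont F (Fin n) (adelicGram F e TV TW))
    (h : ∀ Φ : piSchwartzBruhat F (Fin n), ∃ Φ₀ : (Fin n → AdeleRing (𝓞 F) F) → ℂ, Φ₀ ∈ piSchwartzBruhat F (Fin n) ∧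
      (∀ x, (Φ₀ x).im = 0 ∧ 0 ≤ (Φ₀ x).re) ∧
        ∀ u ∈ C, ∀ x, ‖((adelicMpCont.omega F (Fin n) (adelicGram F e TV TW) (f u) Φ : piSchwartzBruhat F (Fin n)) :
          (Fin n → AdeleRing (𝓞 F) F) → ℂ) x‖ ≤ (Φ₀ x).re)
    (Φ : piSchwartzBruhat F (Fin n)) :
    ∃ Φ₀ : (Fin n → AdeleRing (𝓞 F) F) → ℂ, Φ₀ ∈ piSchwartzBruhat F (Fin n) ∧
      (∀ x, (Φ₀ x).im = 0 ∧ 0 ≤ (Φ₀ x).re) ∧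
        ∀ u ∈ C, ∀ x, ‖((adelicMpCont.omega F (Fin n) (adelicGram F e (PVᵀ * TV * PV) (PWᵀ * TW * PW))
            (congrMp F e hVd hWd hPV hPW (f u)) Φ : piSchwartzBruhat F (Fin n)) :
          (Fin n → AdeleRing (𝓞 F) F) → ℂ) x‖ ≤ (Φ₀ x).re :=
  ((exists_dominating_omega_leviConj F (adelicGram F e TV TW) (isUnit_det_adelicGram F e hVd hWd)
    C f (ratGL F (gramGL F e hPV hPW)⁻¹) h Φ).imp fun _ hΦ₀ =>
    ⟨hΦ₀.1, hΦ₀.2.1, fun u hu x =>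
      (congrArg (fun Θ : piSchwartzBruhat F (Fin n) =>
          ‖((Θ : piSchwartzBruhat F (Fin n)) : (Fin n → AdeleRing (𝓞 F) F) → ℂ) x‖)
        (LinearMap.congr_fun (omega_congrMp F e hVd hWd hPV hPW (f u)) Φ)).trans_le (hΦ₀.2.2 u hu x)⟩)

/-- **THE CONJUGATED-FAMILY FORM** (the shape of the domination letters ★ `exists_piSchwartzBruhat_dominating_omega_conj_pairSplitting_inr_of_signs`:
families `q · g_u · q⁻¹` with `q ∈ Mp_ψ(𝕎_𝔸)ᶜᵒⁿᵗ` fixed): if for every `q` and every `Φ` the family `(ω(q g_u q⁻¹)Φ)_{u ∈ C}` is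
dominated, then for every `q′ ∈ Mp_ψ(𝕎′_𝔸)ᶜᵒⁿᵗ` IN THE IMAGE of `φ` and every `Φ` the family `(ω(q′ (φ g_u) q′⁻¹)Φ)_{u ∈ C}` is dominated
(`φ` is a homomorphism).  [cite: Weil1964, Chap. III n° 41, Lemme 5 p. 194] [cite: GelbartRogawski1991, §3.1 p. 454 L41–42] -/
theorem exists_dominating_omega_conj_congrMp {κ : Type*} (C : Set κ) (g : κ → adelicMpCont F (Fin n) (adelicGram F e TV TW))
    (h : ∀ (q : adelicMpCont F (Fin n) (adelicGram F e TV TW)) (Φ : piSchwartzBruhat F (Fin n)),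
      ∃ Φ₀ : (Fin n → AdeleRing (𝓞 F) F) → ℂ, Φ₀ ∈ piSchwartzBruhat F (Fin n) ∧ (∀ x, (Φ₀ x).im = 0 ∧ 0 ≤ (Φ₀ x).re) ∧
        ∀ u ∈ C, ∀ x, ‖((adelicMpCont.omega F (Fin n) (adelicGram F e TV TW) (q * g u * q⁻¹) Φ : piSchwartzBruhat F (Fin n)) :
          (Fin n → AdeleRing (𝓞 F) F) → ℂ) x‖ ≤ (Φ₀ x).re)
    (q : adelicMpCont F (Fin n) (adelicGram F e TV TW)) (Φ : piSchwartzBruhat F (Fin n)) :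
    ∃ Φ₀ : (Fin n → AdeleRing (𝓞 F) F) → ℂ, Φ₀ ∈ piSchwartzBruhat F (Fin n) ∧
      (∀ x, (Φ₀ x).im = 0 ∧ 0 ≤ (Φ₀ x).re) ∧
        ∀ u ∈ C, ∀ x, ‖((adelicMpCont.omega F (Fin n) (adelicGram F e (PVᵀ * TV * PV) (PWᵀ * TW * PW))
            (congrMp F e hVd hWd hPV hPW q * congrMp F e hVd hWd hPV hPW (g u) * (congrMp F e hVd hWd hPV hPW q)⁻¹) Φ :
              piSchwartzBruhat F (Fin n)) : (Fin n → AdeleRing (𝓞 F) F) → ℂ) x‖ ≤ (Φ₀ x).re :=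
  -- `φ q · φ g_u · (φ q)⁻¹ = φ (q g_u q⁻¹)` (group level, pushed under `ω` by `congrArg`)
  (exists_dominating_omega_congrMp F e hVd hWd hPV hPW C (fun u => q * g u * q⁻¹) (h q) Φ).imp fun _ hΦ₀ =>
    ⟨hΦ₀.1, hΦ₀.2.1, fun u hu x =>
      (congrArg (fun r : adelicMpCont F (Fin n) (adelicGram F e (PVᵀ * TV * PV) (PWᵀ * TW * PW)) =>
          ‖((adelicMpCont.omega F (Fin n) _ r Φ : piSchwartzBruhat F (Fin n)) : (Fin n → AdeleRing (𝓞 F) F) → ℂ) x‖)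
        ((map_mul (congrMp F e hVd hWd hPV hPW) (q * g u) q⁻¹).trans
          (congrArg₂ (· * ·) (map_mul (congrMp F e hVd hWd hPV hPW) q (g u))
            (map_inv (congrMp F e hVd hWd hPV hPW) q))).symm).trans_le (hΦ₀.2.2 u hu x)⟩

end Congr

/-! ## §4 (ED. 2) The inverse direction: domination DESCENDS along `leviConj`, `congrMp` -/

section Inverse

variable (F : Type) [Field F] [NumberField F] {n : ℕ} (T : Matrix (Fin n) (Fin n) (AdeleRing (𝓞 F) F))
  (hT : IsUnit T.det)

/-- `ω(m(b)) (ω(m(b)⁻¹) Ψ) = Ψ` (the representation at `m(b) · m(b)⁻¹ = 1`). [cite: Weil1964, Chap. I n° 13 p. 160] -/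
theorem omega_leviPairCont_omega_inv (b : GL (Fin n) (AdeleRing (𝓞 F) F)) (Ψ : piSchwartzBruhat F (Fin n)) :
    adelicMpCont.omega F (Fin n) T (leviPairCont F T hT b)
        (adelicMpCont.omega F (Fin n) T (leviPairCont F T hT b)⁻¹ Ψ) = Ψ :=
  LinearMap.congr_fun
    ((map_mul (adelicMpCont.omega F (Fin n) T) (leviPairCont F T hT b) (leviPairCont F T hT b)⁻¹).symm.trans
      ((congrArg (adelicMpCont.omega F (Fin n) T) (mul_inv_cancel (leviPairCont F T hT b))).trans
        (map_one (adelicMpCont.omega F (Fin n) T)))) Ψ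

/-- the operator of the INVERSE Levi pair is the inverse twist: `(ω(m(b))⁻¹ Ψ)(y) = Ψ(y ᵥ* bᵀ)` (`((trInv b)⁻¹ : GL) = bᵀ`).
[cite: Weil1964, Chap. I n° 13 p. 160] -/
theorem omega_leviPairCont_inv_apply (b : GL (Fin n) (AdeleRing (𝓞 F) F)) (Ψ : piSchwartzBruhat F (Fin n))
    (y : Fin n → AdeleRing (𝓞 F) F) :
    ((adelicMpCont.omega F (Fin n) T (leviPairCont F T hT b)⁻¹ Ψ : piSchwartzBruhat F (Fin n)) :
        (Fin n → AdeleRing (𝓞 F) F) → ℂ) y =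
      (Ψ : (Fin n → AdeleRing (𝓞 F) F) → ℂ)
        (y ᵥ* (((trInv b)⁻¹ : GL (Fin n) (AdeleRing (𝓞 F) F)) : Matrix (Fin n) (Fin n) (AdeleRing (𝓞 F) F))) := by
  -- evaluate `ω(m b)(ω(m b)⁻¹ Ψ) = Ψ` at `y ᵥ* bᵀ` and use `(y ᵥ* bᵀ) ᵥ* (b⁻¹)ᵀ = y`
  have hy : y ᵥ* (((trInv b)⁻¹ : GL (Fin n) (AdeleRing (𝓞 F) F)) : Matrix (Fin n) (Fin n) (AdeleRing (𝓞 F) F)) ᵥ*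
      ((trInv b : GL (Fin n) (AdeleRing (𝓞 F) F)) : Matrix (Fin n) (Fin n) (AdeleRing (𝓞 F) F)) = y := by
    rw [Matrix.vecMul_vecMul, ← Units.val_mul, inv_mul_cancel, Units.val_one, Matrix.vecMul_one]
  have h := omega_leviPairCont_apply F T hT b (adelicMpCont.omega F (Fin n) T (leviPairCont F T hT b)⁻¹ Ψ)
    (y ᵥ* (((trInv b)⁻¹ : GL (Fin n) (AdeleRing (𝓞 F) F)) : Matrix (Fin n) (Fin n) (AdeleRing (𝓞 F) F)))
  -- no `rw … at h` (isDefEq under `ω`): move the argument with `congrArg … hy` and cancel `ω(m b) ∘ ω(m b)⁻¹` by name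
  exact (congrArg (fun z : Fin n → AdeleRing (𝓞 F) F =>
      ((adelicMpCont.omega F (Fin n) T (leviPairCont F T hT b)⁻¹ Ψ : piSchwartzBruhat F (Fin n)) :
        (Fin n → AdeleRing (𝓞 F) F) → ℂ) z) hy).symm.trans
    (h.symm.trans
      (congrFun (congrArg (fun Θ : piSchwartzBruhat F (Fin n) => ((Θ : piSchwartzBruhat F (Fin n)) :
        (Fin n → AdeleRing (𝓞 F) F) → ℂ)) (omega_leviPairCont_omega_inv F T hT b Ψ)) _))

/-- `ω(p)Φ = ω(m(b))⁻¹ (ω(m(b) p m(b)⁻¹) (ω(m(b)) Φ))`. [cite: Weil1964, Chap. I n° 13 p. 160] -/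
theorem omega_eq_omega_inv_leviConj_apply (b : GL (Fin n) (AdeleRing (𝓞 F) F)) (p : adelicMpCont F (Fin n) T)
    (Φ : piSchwartzBruhat F (Fin n)) :
    adelicMpCont.omega F (Fin n) T p Φ =
      adelicMpCont.omega F (Fin n) T (leviPairCont F T hT b)⁻¹
        (adelicMpCont.omega F (Fin n) T (leviConj F T hT b p) (adelicMpCont.omega F (Fin n) T (leviPairCont F T hT b) Φ)) :=
  -- `p = m(b)⁻¹ · (m(b) p m(b)⁻¹) · m(b)` in the group, then `map_mul` twice
  LinearMap.congr_fun
    ((congrArg (adelicMpCont.omega F (Fin n) T)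
        (show p = (leviPairCont F T hT b)⁻¹ * leviConj F T hT b p * leviPairCont F T hT b by
          rw [leviConj_apply]; group)).trans
      ((map_mul (adelicMpCont.omega F (Fin n) T) _ _).trans
        (congrArg (· * adelicMpCont.omega F (Fin n) T (leviPairCont F T hT b))
          (map_mul (adelicMpCont.omega F (Fin n) T) _ _)))) Φ

/-- **DOMINATION DESCENDS ALONG LEVI CONJUGATION** (the inverse of `exists_dominating_omega_leviConj`): if for every `Φ` the conjugated
family `(ω(m(b) p_u m(b)⁻¹)Φ)_{u ∈ C}` is dominated, then so is `(ω(p_u)Φ)_{u ∈ C}`. [cite: Weil1964, Chap. III n° 41, Lemme 5 p. 194] -/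
theorem exists_dominating_omega_of_leviConj {κ : Type*} (C : Set κ) (f : κ → adelicMpCont F (Fin n) T)
    (b : GL (Fin n) (AdeleRing (𝓞 F) F))
    (h : ∀ Φ : piSchwartzBruhat F (Fin n), ∃ Φ₀ : (Fin n → AdeleRing (𝓞 F) F) → ℂ, Φ₀ ∈ piSchwartzBruhat F (Fin n) ∧
      (∀ x, (Φ₀ x).im = 0 ∧ 0 ≤ (Φ₀ x).re) ∧
        ∀ u ∈ C, ∀ x, ‖((adelicMpCont.omega F (Fin n) T (leviConj F T hT b (f u)) Φ : piSchwartzBruhat F (Fin n)) :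
          (Fin n → AdeleRing (𝓞 F) F) → ℂ) x‖ ≤ (Φ₀ x).re)
    (Φ : piSchwartzBruhat F (Fin n)) :
    ∃ Φ₀ : (Fin n → AdeleRing (𝓞 F) F) → ℂ, Φ₀ ∈ piSchwartzBruhat F (Fin n) ∧
      (∀ x, (Φ₀ x).im = 0 ∧ 0 ≤ (Φ₀ x).re) ∧
        ∀ u ∈ C, ∀ x, ‖((adelicMpCont.omega F (Fin n) T (f u) Φ : piSchwartzBruhat F (Fin n)) :
          (Fin n → AdeleRing (𝓞 F) F) → ℂ) x‖ ≤ (Φ₀ x).re :=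
  (h (adelicMpCont.omega F (Fin n) T (leviPairCont F T hT b) Φ)).elim fun Φ₀' hΦ₀' =>
    ⟨((adelicMpCont.omega F (Fin n) T (leviPairCont F T hT b)⁻¹ ⟨Φ₀', hΦ₀'.1⟩ : piSchwartzBruhat F (Fin n)) :
        (Fin n → AdeleRing (𝓞 F) F) → ℂ),
      (adelicMpCont.omega F (Fin n) T (leviPairCont F T hT b)⁻¹ ⟨Φ₀', hΦ₀'.1⟩).2,
      fun x =>
        ⟨(congrArg Complex.im (omega_leviPairCont_inv_apply F T hT b ⟨Φ₀', hΦ₀'.1⟩ x)).trans (hΦ₀'.2.1 _).1,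
          (hΦ₀'.2.1 _).2.trans_eq (congrArg Complex.re (omega_leviPairCont_inv_apply F T hT b ⟨Φ₀', hΦ₀'.1⟩ x)).symm⟩,
      fun u hu x =>
        (congrArg (fun z : ℂ => ‖z‖)
          ((congrFun (congrArg (fun Θ' : piSchwartzBruhat F (Fin n) => ((Θ' : piSchwartzBruhat F (Fin n)) :
              (Fin n → AdeleRing (𝓞 F) F) → ℂ)) (omega_eq_omega_inv_leviConj_apply F T hT b (f u) Φ)) x).trans
            (omega_leviPairCont_inv_apply F T hT b _ x))).trans_le
          ((hΦ₀'.2.2 u hu _).trans_eq (congrArg Complex.re (omega_leviPairCont_inv_apply F T hT b ⟨Φ₀', hΦ₀'.1⟩ x)).symm)⟩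

end Inverse

section CongrInverse

variable (F : Type) [Field F] [NumberField F] {N M n : ℕ} (e : Fin N × Fin M ≃ Fin n)
  {TV : Matrix (Fin N) (Fin N) F} {TW : Matrix (Fin M) (Fin M) F}
  (hVd : IsUnit TV.det) (hWd : IsUnit TW.det)
  {PV : Matrix (Fin N) (Fin N) F} {PW : Matrix (Fin M) (Fin M) F} (hPV : IsUnit PV.det) (hPW : IsUnit PW.det)

/-- **DOMINATION DESCENDS ALONG THE CONGRUENCE TRANSPORT** (the inverse of `exists_dominating_omega_congrMp`): if for every `Φ` the
transported family `(ω(φ p_u)Φ)_{u ∈ C}` is dominated at the congruent data, then `(ω(p_u)Φ)_{u ∈ C}` is dominated at the original data —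
so Lemme 5 may be invoked on EITHER side of a congruence. [cite: Weil1964, Chap. III n° 41, Lemme 5 p. 194]
[cite: GelbartRogawski1991, §3.1 p. 454 L41–42] -/
theorem exists_dominating_omega_of_congrMp {κ : Type*} (C : Set κ) (f : κ → adelicMpCont F (Fin n) (adelicGram F e TV TW))
    (h : ∀ Φ : piSchwartzBruhat F (Fin n), ∃ Φ₀ : (Fin n → AdeleRing (𝓞 F) F) → ℂ, Φ₀ ∈ piSchwartzBruhat F (Fin n) ∧
      (∀ x, (Φ₀ x).im = 0 ∧ 0 ≤ (Φ₀ x).re) ∧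
        ∀ u ∈ C, ∀ x, ‖((adelicMpCont.omega F (Fin n) (adelicGram F e (PVᵀ * TV * PV) (PWᵀ * TW * PW))
            (congrMp F e hVd hWd hPV hPW (f u)) Φ : piSchwartzBruhat F (Fin n)) :
          (Fin n → AdeleRing (𝓞 F) F) → ℂ) x‖ ≤ (Φ₀ x).re)
    (Φ : piSchwartzBruhat F (Fin n)) :
    ∃ Φ₀ : (Fin n → AdeleRing (𝓞 F) F) → ℂ, Φ₀ ∈ piSchwartzBruhat F (Fin n) ∧
      (∀ x, (Φ₀ x).im = 0 ∧ 0 ≤ (Φ₀ x).re) ∧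
        ∀ u ∈ C, ∀ x, ‖((adelicMpCont.omega F (Fin n) (adelicGram F e TV TW) (f u) Φ : piSchwartzBruhat F (Fin n)) :
          (Fin n → AdeleRing (𝓞 F) F) → ℂ) x‖ ≤ (Φ₀ x).re :=
  exists_dominating_omega_of_leviConj F (adelicGram F e TV TW) (isUnit_det_adelicGram F e hVd hWd) C f
    (ratGL F (gramGL F e hPV hPW)⁻¹)
    (fun Ψ => (h Ψ).imp fun _ hΦ₀ =>
      ⟨hΦ₀.1, hΦ₀.2.1, fun u hu x =>
        (congrArg (fun Θ : piSchwartzBruhat F (Fin n) =>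
            ‖((Θ : piSchwartzBruhat F (Fin n)) : (Fin n → AdeleRing (𝓞 F) F) → ℂ) x‖)
          (LinearMap.congr_fun (omega_congrMp F e hVd hWd hPV hPW (f u)) Ψ)).symm.trans_le (hΦ₀.2.2 u hu x)⟩)
    Φ

end CongrInverse

end UnitaryDualPair

end Literature.NumberTheory.GelbartRogawski1991
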